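import Summits.Ventures.PercRepro.ProfileGapMonoColoopBandSucc

/-!
# PercRepro — THE THRESHOLD FAMILY AT CO-RANK ONE (p5, gen 23; `proofs/P5-GM1.md` §21(n), the base `q = 1` of the
assembly; announced INBOX 11627)

At `q = 1` the rank-`0` sets are the sets of loops, every one with a spanning complement (demand `ρ(E)` when
`ρ(E) ≥ t + 1`), and for every set of loops `B` and every element `x` of a fixed basis the set `B ∪ x` has rank `1`
and a complement of rank `≥ ρ(E) − 1 ≥ t`; the map `(B, x) ↦ B ∪ x` is injective, so `#T_t(N) ≥ ρ(E) · #R_0(N)` and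
`(I_t)` holds at co-rank `1` for every `t`.

* `rk_sdiff_of_rk_eq_zero`, `rk_insert_of_rk_eq_zero`, **`thresholdIneq_one`**.
-/

open scoped Matroid

namespace PercRepro.Cogirth

open Finset ThmH Skew Shadow Profile

variable {α : Type} [DecidableEq α] {M : Matroid α} [M.Finite]

section ThresholdOne

variable {N : Matroid α} [N.Finite]

/-- Removing a set of loops does not change the rank of a subset of the ground set. -/
theorem rk_sdiff_of_rk_eq_zero {B : Finset α} (hB : B ⊆ gr N) (h0 : rk N B = 0) {X : Finset α} (hX : X ⊆ gr N) :
    rk N (X \ B) = rk N X := by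
  induction B using Finset.induction_on with
  | empty => rw [sdiff_empty]
  | insert b B hbB ih =>
    have hB' : B ⊆ gr N := (subset_insert b B).trans hB
    have hb : b ∈ gr N := hB (mem_insert_self b B)
    have h0' : rk N B = 0 := by
      have := rk_mono' (M := N) (subset_insert b B)
      omega
    have hb0 : rk N {b} = 0 := by
      have := rk_mono' (M := N) (singleton_subset_iff.2 (mem_insert_self b B))
      omega
    have h1 : X \ insert b B = (X \ B).erase b := by
      ext x
      simp only [mem_sdiff, mem_insert, mem_erase, not_or]
      tauto
    rw [h1, rk_erase_of_loop hb hb0 (sdiff_subset.trans hX), ih hB' h0']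

/-- Adding a set of loops does not change the rank. -/
theorem rk_insert_of_rk_eq_zero {B : Finset α} (hB : B ⊆ gr N) (h0 : rk N B = 0) {X : Finset α}
    (hX : X ⊆ gr N) : rk N (X ∪ B) = rk N X := by
  have h := rk_sdiff_of_rk_eq_zero hB h0 (X := X ∪ B) (union_subset hX hB)
  have h2 : (X ∪ B) \ B = X \ B := by
    ext x
    simp only [mem_sdiff, mem_union]
    tauto
  rw [h2, rk_sdiff_of_rk_eq_zero hB h0 hX] at h
  exact h.symm

/-- **`(I_t)` at co-rank `1`, for every `t`.** -/
theorem thresholdIneq_one (N : Matroid α) [N.Finite] (t : ℕ) : ThresholdIneq N 1 t := by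
  unfold ThresholdIneq thresholdSum
  -- every rank-`0` set has a spanning complement
  have hterm : ∀ B ∈ Rq N (1 - 1),
      (if t + 1 ≤ rk N (gr N \ B) then rk N (gr N \ B) else 0) =
        (if t + 1 ≤ rk N (gr N) then rk N (gr N) else 0) := by
    intro B hB
    rw [mem_Rq] at hB
    have h0 : rk N B = 0 := rk_eq_of_eRk_eq_cq hB.2
    rw [rk_sdiff_of_rk_eq_zero hB.1 h0 (Subset.refl _)]
  rw [sum_congr rfl hterm, sum_const, smul_eq_mul]
  by_cases hR : t + 1 ≤ rk N (gr N)
  · rw [if_pos hR]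
    -- a basis `I` of the ground set, `#I = ρ(E)`
    obtain ⟨I, hIg, hIcard, hIind⟩ := exists_basis_finset (M := N)
    -- the injection `(B, x) ↦ insert x B`
    have hmaps : ∀ p ∈ (Rq N (1 - 1)) ×ˢ I, insert p.2 p.1 ∈ levelSetCoQ N t 1 := by
      rintro ⟨B, x⟩ hp
      rw [mem_product] at hp
      obtain ⟨hB, hx⟩ := hp
      rw [mem_Rq] at hB
      have h0 : rk N B = 0 := rk_eq_of_eRk_eq_cq hB.2
      have hxg : x ∈ gr N := hIg hx
      have hx1 : rk N {x} = 1 := by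
        have := rk_eq_card_of_indep (M := N) (I := {x}) (hIind.subset (by simpa using hx))
        simpa using this
      rw [mem_levelSetCoQ]
      refine ⟨⟨insert_subset hxg hB.1, ?_⟩, ?_⟩
      · apply eRk_eq_of_rk_eq_cq
        rw [insert_eq, rk_insert_of_rk_eq_zero hB.1 h0 (singleton_subset_iff.2 hxg), hx1]
      · have h1 : gr N \ insert x B = (gr N \ B).erase x := by
          ext y
          simp only [mem_sdiff, mem_insert, mem_erase, not_or]
          tauto
        have h2 : rk N (gr N \ B) = rk N (gr N) := rk_sdiff_of_rk_eq_zero hB.1 h0 (Subset.refl _)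
        have h3 : rk N (gr N \ B) ≤ rk N ((gr N \ B).erase x) + 1 := by
          by_cases hxB : x ∈ gr N \ B
          · have := rk_insert_eq hxg (X := (gr N \ B).erase x) ((erase_subset _ _).trans sdiff_subset)
            rw [insert_erase hxB] at this
            split_ifs at this <;> omega
          · rw [erase_eq_of_notMem hxB]; omega
        rw [h1]; omega
    have hinj : Set.InjOn (fun p : Finset α × α => insert p.2 p.1)
        (((Rq N (1 - 1)) ×ˢ I : Finset (Finset α × α)) : Set (Finset α × α)) := by
      rintro ⟨B₁, x₁⟩ hp₁ ⟨B₂, x₂⟩ hp₂ heq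
      simp only [coe_product, Set.mem_prod, mem_coe] at hp₁ hp₂
      simp only at heq
      -- `x_i` is the unique non-loop of `insert x_i B_i`
      have key : ∀ (B : Finset α) (x : α), B ∈ Rq N 0 → x ∈ I → ∀ y ∈ insert x B, rk N {y} = 1 → y = x := by
        intro B x hB hx y hy hy1
        rw [mem_insert] at hy
        rcases hy with rfl | hyB
        · rfl
        · exfalso
          rw [mem_Rq] at hB
          have h0 : rk N B = 0 := rk_eq_of_eRk_eq_cq hB.2
          have := rk_mono' (M := N) (singleton_subset_iff.2 hyB)
          omega
      have hx₁1 : rk N {x₁} = 1 := by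
        have := rk_eq_card_of_indep (M := N) (I := {x₁}) (hIind.subset (by simpa using hp₁.2))
        simpa using this
      have hx₂1 : rk N {x₂} = 1 := by
        have := rk_eq_card_of_indep (M := N) (I := {x₂}) (hIind.subset (by simpa using hp₂.2))
        simpa using this
      have hx : x₁ = x₂ := by
        have h := key B₂ x₂ hp₂.1 hp₂.2 x₁ (by rw [← heq]; exact mem_insert_self _ _) hx₁1
        exact h
      subst hx
      have hx₁B₁ : x₁ ∉ B₁ := by
        intro h
        rw [mem_Rq] at hp₁
        have h0 : rk N B₁ = 0 := rk_eq_of_eRk_eq_cq hp₁.1.2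
        have := rk_mono' (M := N) (singleton_subset_iff.2 h)
        omega
      have hx₁B₂ : x₁ ∉ B₂ := by
        intro h
        rw [mem_Rq] at hp₂
        have h0 : rk N B₂ = 0 := rk_eq_of_eRk_eq_cq hp₂.1.2
        have := rk_mono' (M := N) (singleton_subset_iff.2 h)
        omega
      have hB : B₁ = B₂ := by
        rw [← erase_insert hx₁B₁, ← erase_insert hx₁B₂, heq]
      rw [hB]
    have hcard := card_le_card_of_injOn (fun p : Finset α × α => insert p.2 p.1) hmaps hinj
    rw [card_product, hIcard] at hcard
    calc (Rq N (1 - 1)).card * rk N (gr N) ≤ (levelSetCoQ N t 1).card := hcard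
      _ = 1 * (levelSetCoQ N t 1).card := (one_mul _).symm
  · rw [if_neg hR, mul_zero]
    exact Nat.zero_le _

end ThresholdOne

end PercRepro.Cogirth
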